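import Mathlib
import Summits.ValiantsHypothesis.ValiantsHypothesis.Theorems.FifoMatchingNNLowDegreeCofactorHardCofactorBuysVertices
import Summits.ValiantsHypothesis.ValiantsHypothesis.Theorems.FifoMatchingNNLowDegreeCofactorHardStubCarveInterval
import Summits.ValiantsHypothesis.ValiantsHypothesis.Theorems.FifoMatchingNNLowDegreeCofactorHardSupportGenericExpBound
import Literature.Computability.AlgebraicComplexity.NestFreeMatchingPoly
import HarnessLib

/-!
# Route FifoMatching — crux `NNDivisionHard` (stmt-ValiantsHypothesis-21181): the SUBLINEAR-DEGREE RANGE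

`NNDivisionHard` (the load-bearing child of the split of `NNNotVP`): for every `c` and all large `n`,
EVERY nonzero cofactor `h ∈ ℝ≥0[x]` has `2^((log₂ n + c)^c) < L₊(NN_n · h) + L₊(h)`.  The just-closed rung
`NNLowDegreeCofactorHard` (stmt-22993) is the range `deg h ≤ d`, `d` fixed.  This file pushes the
freed-vertices method of that rung to its natural limit — cofactors of degree up to `n / polylog n`:

* `nnDivisionHard_of_degree_budget` — for every `c` and all large `n`, every nonzero `h` with
  `(2·deg h + 1)·(((log₂ n + c)^c + log₂ n + 1)^6 + 2) ≤ n` satisfies the conclusion of `NNDivisionHard`.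

Proof = composition of landed engines: S1 `stub_cofactorBuysVertices` (a cofactor of degree `δ` buys at
most `2δ` freed vertices; any `h`), S2 `FreedVertices.stub_carveInterval` (a polynomial with the support
of `NN_{n'}`, `n ≤ (2δ+1)(n'+2)`, of no larger monotone complexity; any vertex set), and the support-generic
thick-queue bound `exp_lower_bound_of_support_eq` (`2^{n'^{1/6}} ≤ L₊(g)` for `n' ≥ n₁`); the degree budget
is exactly what makes `n' ≥ ((log₂ n + c)^c + log₂ n + 1)^6`, hence `n' ≥ n₁` (once `log₂ n ≥ n₁`) and
`(log₂ n + c)^c + 1 ≤ n'^{1/6}`.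

WHY THE METHOD STOPS HERE (the residual of 21181, for the planner): the carved interval has length
`2n' ≈ 2n/(2·deg h + 1)` and the thick-queue bound needs `n'^{1/6} > (log₂ n + c)^c`, so the degree budget is
exactly what S2's interval carving consumes; cofactors of degree `Ω(n / polylog n)` and beyond — in particular
the UNBOUNDED degrees produced by the Hrubeš–Yehudayoff normal form of a circuit with one division — leave no
interval to carve and need a different engine (that residual range IS the open content of `NNDivisionHard`).

HONEST FRAMING: a PARTIAL RANGE of the OPEN crux `NNDivisionHard`; the crux is NOT claimed and stays OPEN;
`NNNotVP` and VP ≠ VNP are NOT proved; monotone ≠ general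
(`Literature.Barriers.ValiantsHypothesis.MonotoneGap`).  No definitions, no named facts.
-/

noncomputable section

-- Sub = Summit single-conjunct layout: the duplicated namespace component is mandated by the tree.
set_option linter.dupNamespace false

namespace Summit.ValiantsHypothesis.ValiantsHypothesis.Theorems.FifoMatching.NNLowDegreeCofactorHard

open MvPolynomial Literature.Computability.AlgebraicComplexity
open scoped NNReal

/-- **`NNDivisionHard` in the sublinear-degree range.** For every `c` there is `n₀` such that for all
`n ≥ n₀` and every nonzero `h ∈ ℝ≥0[x_(i,j)]` whose degree satisfies the budget
`(2·deg h + 1)·(((log₂ n + c)^c + log₂ n + 1)^6 + 2) ≤ n` (so `deg h` may grow like `n / polylog n`):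
`2^((log₂ n + c)^c) < L₊(NN_n · h) + L₊(h)`.  (Freed vertices `→` carved interval `→` support-generic
thick-queue bound; the budget gives `n' ≥ ((log₂ n + c)^c + log₂ n + 1)^6`.) [folklore] -/
theorem nnDivisionHard_of_degree_budget :
    ∀ c : ℕ, ∃ n₀ : ℕ, ∀ n ≥ n₀, ∀ h : MvPolynomial (Fin (2 * n) × Fin (2 * n)) ℝ≥0, h ≠ 0 →
      (2 * h.totalDegree + 1) * (((Nat.log 2 n + c) ^ c + Nat.log 2 n + 1) ^ 6 + 2) ≤ n →
        2 ^ ((Nat.log 2 n + c) ^ c) <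
          complexity (nestFreeMatchingPoly n ℝ≥0 * h) + complexity h := by
  intro c
  obtain ⟨n₁, hn₁⟩ := exp_lower_bound_of_support_eq
  refine ⟨2 ^ n₁, fun n hn h hh hbudget => ?_⟩
  -- freed vertices, then a carved interval
  obtain ⟨R, hR, q, hq, hqc⟩ := stub_cofactorBuysVertices n h hh
  obtain ⟨n', hn', g, hg, hgc⟩ := FreedVertices.stub_carveInterval n R q hq
  set k := Nat.log 2 n with hk
  set A := (k + c) ^ c with hA
  -- the budget gives `n' ≥ (A + k + 1)^6`
  have hRd : R.card + 1 ≤ 2 * h.totalDegree + 1 := by omega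
  have hle : n ≤ (2 * h.totalDegree + 1) * (n' + 2) := hn'.trans (Nat.mul_le_mul_right _ hRd)
  have hB : (A + k + 1) ^ 6 ≤ n' := by
    have h1 : (2 * h.totalDegree + 1) * ((A + k + 1) ^ 6 + 2) ≤ (2 * h.totalDegree + 1) * (n' + 2) :=
      hbudget.trans hle
    have := Nat.le_of_mul_le_mul_left h1 (by omega)
    omega
  -- `n' ≥ n₁`: `k ≥ n₁` and `n' ≥ (k+1)^6 ≥ k + 1`
  have hnpos : n ≠ 0 := by
    have : 0 < 2 ^ n₁ := by positivity
    omega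
  have hk₁ : n₁ ≤ k := Nat.le_log_of_pow_le (by norm_num) hn
  have hk6 : A + k + 1 ≤ (A + k + 1) ^ 6 := by
    calc A + k + 1 = (A + k + 1) ^ 1 := (pow_one _).symm
      _ ≤ (A + k + 1) ^ 6 := Nat.pow_le_pow_right (by omega) (by norm_num)
  have hn'1 : n₁ ≤ n' := by omega
  -- `A + 1 ≤ n'^{1/6}`
  have hA6 : (A + 1) ^ 6 ≤ n' := (Nat.pow_le_pow_left (by omega) 6).trans hB
  have hroot : (((A + 1 : ℕ) : ℝ)) ≤ (n' : ℝ) ^ ((1 : ℝ) / 6) := by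
    have hcast : (((A + 1 : ℕ) : ℝ)) ^ 6 ≤ (n' : ℝ) := by exact_mod_cast hA6
    have h := Real.rpow_le_rpow (by positivity) hcast (by norm_num : (0 : ℝ) ≤ 1 / 6)
    have h6 : ((((A + 1 : ℕ) : ℝ)) ^ 6) ^ ((1 : ℝ) / 6) = ((A + 1 : ℕ) : ℝ) := by
      rw [show ((1 : ℝ) / 6) = ((6 : ℕ) : ℝ)⁻¹ by norm_num]
      exact Real.pow_rpow_inv_natCast (by positivity) (by norm_num)
    rw [h6] at h
    exact h
  -- the thick-queue bound for `g`
  have hmain := hn₁ n' hn'1 g hg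
  have hfinal : (((2 ^ (A + 1) : ℕ) : ℝ)) ≤ (complexity g : ℝ) := by
    calc (((2 ^ (A + 1) : ℕ) : ℝ)) = (2 : ℝ) ^ (((A + 1 : ℕ) : ℝ)) := by
          rw [Real.rpow_natCast]; push_cast; ring
      _ ≤ (2 : ℝ) ^ ((n' : ℝ) ^ ((1 : ℝ) / 6)) :=
          Real.rpow_le_rpow_of_exponent_le (by norm_num) hroot
      _ ≤ _ := hmain
  have hfinal' : 2 ^ (A + 1) ≤ complexity g := by exact_mod_cast hfinal
  calc 2 ^ ((Nat.log 2 n + c) ^ c) = 2 ^ A := by rw [hA]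
    _ < 2 ^ (A + 1) := Nat.pow_lt_pow_right (by norm_num) (by omega)
    _ ≤ complexity g := hfinal'
    _ ≤ complexity q := hgc
    _ ≤ complexity (nestFreeMatchingPoly n ℝ≥0 * h) := hqc
    _ ≤ complexity (nestFreeMatchingPoly n ℝ≥0 * h) + complexity h := Nat.le_add_right _ _

end Summit.ValiantsHypothesis.ValiantsHypothesis.Theorems.FifoMatching.NNLowDegreeCofactorHard

end
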